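import Summits.QuantumFields.YangMills.Theorems.FluctuationComparisonRegPrIntLS2BetaFaceTubeCounts
import Summits.QuantumFields.YangMills.Theorems.FluctuationComparisonRegPrIntLS2BetaAveragingWordCounts
import HarnessLib

/-!
# S2β · AVG₂♭-ax_q, THE SUP CHAIN — TOP-JENSEN's LATTICE HALF, FILE B: THE RUNS OF (0.4) THROUGH THE FACE, AND THE JENSEN LEAF TERM
# (every straight run `[x, x + Le_μ]` of the (0.4) average at `c` crosses the face of `c` EXACTLY ONCE, at step `t = L − 1 − r_μ`; each face bond carries exactly `L`
# runs per ordering pair, `(d!)²·L` over the full index set `Idx P`; `Σ_B (N_f⁻¹·Σ_{tube_n(B)} w)² ≤ N_f⁻¹·Σ_ℓ w²`, `N_f = (L^{d−1})^n`)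

Cell `ym3-torus` (YM ladder rung R3 = continuum `SU(2)` Yang–Mills on the three-torus at fixed lattice data — a RUNG: NOT d = 4, NOT infinite volume,
NOT a mass gap, NOT Clay).  Width seat «width 20» `ym3-torus-px20` (gen 24), FREE px helper on crux `stmt-QuantumFields-20520`
(`…Theses.UnitScaleTilt.FluctuationComparisonRegPrIntL`), LINE g18-1 S2β, (ST) sup chain, `c₃` (TOP∕FACE-Jensen) row of ✓p830683 `supTower_of_liftLadder₃`.
Sequel of FILE A ✓`…S2BetaFaceTubeCounts` (face sets, tubes, partition).  WHY THIS FILE: px17 g22 18:22:11Z LOCATE for (O3) «the tree's (0.4) average runs over ALL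
`(d!)²·L^d` index triples `(x, σ, σ′)` (lit `BlockAveraging.Idx P`, `x = blockSite c₋ r`) — (O2) counts: index over `(x, σ, σ′)`, not faces only»: §6 is the
RUN → FACE bridge in the lit's run currency `⟨shiftN (Site.blockSite c₋ r) (dir c) t, dir c⟩` ([Balaban1987RG1] p.267 geometry, lit ✓`B12B0LoopGeometry267.
blockOf_shiftN_blockSite_of_le ∕ _of_ge`, ✓p828875 `sum_idx_const_perm`), so that a uniform mean over the runs of a function of the crossed face bond IS the
uniform mean over the `L^{d−1}` face bonds (the spine's `(Σ_{π j = i} w j)∕c`); §5 is the leaf term of ✓p830761 `energy_top_le` (`(c⁻¹)^m·E m`) against the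
purse `Σ_ℓ ‖ζ ℓ‖²`: Jensen per tube with FILE A's ✓`card_tube`, then FILE A's partition ✓`sum_sum_tube_le`.
`--kind proof --supports stmt-QuantumFields-20520 --as helper`, count-neutral, DEFINITION-FREE (0 `def`, 0 `instance`, 0 `notation`, 0 `sorry`), default
heartbeats; generic `P : Params`, standing range `j + 1 ≤ m + K` (§6) ∕ `n ≤ m + K` (§5).

WHAT IS PROVED (sorry-free).
* §5 `sq_sum_tube_le` (`(Σ_{tube_n(B)} w)² ≤ (L^{d−1})^n·Σ_{tube_n(B)} w²`), ★★`sum_sq_mean_tube_le` (`Σ_B ((Σ_{tube_n(B)} w)∕(L^{d−1})^n)² ≤ (Σ_ℓ w²)∕(L^{d−1})^n`).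
* §6 ★`run_step_face_iff` (the bond `⟨x + te_μ, μ⟩`, `x = blockSite c₋ r`, `t < L`, is a face bond of `c` iff `r_μ + t = L − 1`), ★`card_run_face` (exactly ONE step of
  each run crosses), `run_face_site_eq` (the crossing site in closed form: offset `r` with `r_μ ↦ L − 1`), `sum_face_eq_sum_offset` (the face set read through the
  offsets with `r_μ = L − 1`, lit `Site.blockEquiv`), ★★`sum_offset_run_face` (`Σ_r g(crossing bond of run r) = L • Σ_{f ∈ face(c)} g f` — each face bond is crossed
  by exactly `L` runs), ★★`sum_idx_run_face` (over `Idx P`: multiplicity `(d!)²·L`).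

HONEST SCOPE.  Finite torus combinatorics of the tree's own block sites and straight runs plus one Cauchy–Schwarz; no group, no analysis beyond `Finset` sums of
reals; nothing of Bałaban's is asserted or proved; the run∕face-MEAN identity for the non-abelian chords (px17 g22's (O3)) is NOT here; (TOP-LAD)∕(LIFT-LAD)∕
(SCT₁₂₃)∕(ST′)∕(ST)∕LOC, GAP♯∘ (registry 3732b7df UNTOUCHED, 0∕5), the five REGISTERED stubs, S2β, crux 20520, 19936, 19200 and `YM3TorusSU2` are NOT proved; no summit
statement is proved by a helper; rung R3 = SU(2) YM₃ on T³ at fixed lattice data — NOT d = 4, NOT infinite volume, NOT a mass gap, NOT Clay; the Yang–Mills mass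
gap is NOT proved.  Axioms standard.

References: T. Bałaban, CMP **109** (1987) 249–301 [Balaban1987RG1] ((0.3)–(0.4) pp.252–253, the straight segment `[x, x′]` of the averaging contour; p.267);
CMP **98** (1985) 17–51 [Balaban1985Averaging] ((9) p.19).
-/

set_option autoImplicit false

open Finset

namespace Summit.QuantumFields.YangMills.Theorems.FluctuationComparisonRegPrIntLS2BetaFaceTubeRuns

open Literature.MathematicalPhysics.QuantumFieldTheory.Balaban1983to89
open Literature.MathematicalPhysics.QuantumFieldTheory.Balaban1983to89.B14.Eq22Determines (blockIter blockIter_zero blockIter_succ)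
open Literature.MathematicalPhysics.QuantumFieldTheory.Balaban1983to89.B10Eq47AxialChi (shiftN shiftN_zero shiftN_succ)
open Literature.MathematicalPhysics.QuantumFieldTheory.Balaban1983to89.B12B0LoopGeometry267 (shiftN_blockSite_eq_of_le blockOf_shiftN_blockSite_of_le
  blockOf_shiftN_blockSite_of_ge)
open Literature.MathematicalPhysics.QuantumFieldTheory.Balaban1983to89.BlockAveraging (Idx)
open Summit.QuantumFields.YangMills.Theorems.FluctuationComparisonRegPrIntLS2BetaAveragingWordCounts (sum_idx_const_perm)
open Literature.MathematicalPhysics.QuantumFieldTheory.Balaban1983to89.B12SmallFieldDomain259 (src_ne_tgt)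
open Summit.QuantumFields.YangMills.Theorems.FluctuationComparisonRegPrIntLS2BetaFaceTubeCounts (mem_face_iff card_tube sum_sum_tube_le)

variable {P : Params} {j : ℕ}

/-! ## §5 Jensen over the tube: the top energy from the leaves -/

/-- Jensen∕Cauchy–Schwarz on one tube: `(Σ_{tube} w)² ≤ (L^{d−1})^n · Σ_{tube} w²`. [folklore] -/
theorem sq_sum_tube_le (n : ℕ) (hn : n ≤ P.m + P.K) (B : PBond P n) (w : PBond P 0 → ℝ) :
    (∑ ℓ ∈ univ.filter (fun ℓ : PBond P 0 => ℓ.dir = B.dir ∧ blockIter n ℓ.src = B.src ∧ blockIter n ℓ.tgt = B.tgt), w ℓ) ^ 2 ≤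
      (((P.L : ℝ) ^ (P.d - 1)) ^ n) *
        ∑ ℓ ∈ univ.filter (fun ℓ : PBond P 0 => ℓ.dir = B.dir ∧ blockIter n ℓ.src = B.src ∧ blockIter n ℓ.tgt = B.tgt), w ℓ ^ 2 := by
  have h := sq_sum_le_card_mul_sum_sq
    (s := univ.filter (fun ℓ : PBond P 0 => ℓ.dir = B.dir ∧ blockIter n ℓ.src = B.src ∧ blockIter n ℓ.tgt = B.tgt)) (f := w)
  rw [card_tube n hn B] at h
  push_cast at h
  exact h

/-- ★★ **THE TOP ENERGY OF THE TUBE MEANS IS `N_f⁻¹ ×` THE LEAF ENERGY**, `N_f = (L^{d−1})^n` (`= N²` at `d = 3`):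
`Σ_B (N_f⁻¹·Σ_{ℓ ∈ tube_n(B)} w ℓ)² ≤ N_f⁻¹·Σ_ℓ (w ℓ)²` — Jensen per tube, then the disjointness of the tubes. [folklore] -/
theorem sum_sq_mean_tube_le (n : ℕ) (hn : n ≤ P.m + P.K) (w : PBond P 0 → ℝ) :
    ∑ B : PBond P n,
        ((∑ ℓ ∈ univ.filter (fun ℓ : PBond P 0 => ℓ.dir = B.dir ∧ blockIter n ℓ.src = B.src ∧ blockIter n ℓ.tgt = B.tgt), w ℓ) /
            ((P.L : ℝ) ^ (P.d - 1)) ^ n) ^ 2 ≤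
      (∑ ℓ : PBond P 0, w ℓ ^ 2) / ((P.L : ℝ) ^ (P.d - 1)) ^ n := by
  have hL : (0 : ℝ) < P.L := by exact_mod_cast P.L_pos
  have hN : (0 : ℝ) < ((P.L : ℝ) ^ (P.d - 1)) ^ n := by positivity
  calc ∑ B : PBond P n,
        ((∑ ℓ ∈ univ.filter (fun ℓ : PBond P 0 => ℓ.dir = B.dir ∧ blockIter n ℓ.src = B.src ∧ blockIter n ℓ.tgt = B.tgt), w ℓ) /
            ((P.L : ℝ) ^ (P.d - 1)) ^ n) ^ 2
      ≤ ∑ B : PBond P n,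
          (∑ ℓ ∈ univ.filter (fun ℓ : PBond P 0 => ℓ.dir = B.dir ∧ blockIter n ℓ.src = B.src ∧ blockIter n ℓ.tgt = B.tgt), w ℓ ^ 2) /
            ((P.L : ℝ) ^ (P.d - 1)) ^ n := by
        refine sum_le_sum fun B _ => ?_
        rw [div_pow, div_le_div_iff₀ (pow_pos hN 2) hN]
        calc (∑ ℓ ∈ univ.filter (fun ℓ : PBond P 0 => ℓ.dir = B.dir ∧ blockIter n ℓ.src = B.src ∧ blockIter n ℓ.tgt = B.tgt), w ℓ) ^ 2 *
              ((P.L : ℝ) ^ (P.d - 1)) ^ n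
            ≤ ((((P.L : ℝ) ^ (P.d - 1)) ^ n) *
                ∑ ℓ ∈ univ.filter (fun ℓ : PBond P 0 => ℓ.dir = B.dir ∧ blockIter n ℓ.src = B.src ∧ blockIter n ℓ.tgt = B.tgt), w ℓ ^ 2) *
              ((P.L : ℝ) ^ (P.d - 1)) ^ n := mul_le_mul_of_nonneg_right (sq_sum_tube_le n hn B w) hN.le
          _ = _ := by ring
    _ = (∑ B : PBond P n,
          ∑ ℓ ∈ univ.filter (fun ℓ : PBond P 0 => ℓ.dir = B.dir ∧ blockIter n ℓ.src = B.src ∧ blockIter n ℓ.tgt = B.tgt), w ℓ ^ 2) /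
            ((P.L : ℝ) ^ (P.d - 1)) ^ n := by rw [sum_div]
    _ ≤ (∑ ℓ : PBond P 0, w ℓ ^ 2) / ((P.L : ℝ) ^ (P.d - 1)) ^ n :=
        div_le_div_of_nonneg_right (sum_sum_tube_le n (fun ℓ => w ℓ ^ 2) fun ℓ => sq_nonneg _) hN.le

/-! ## §6 Runs: every straight run of the (0.4) average crosses the face exactly once; each face bond carries `L` runs per ordering pair -/

/-- **THE RUN THROUGH `x = blockSite c₋ r` CROSSES THE FACE OF `c` EXACTLY AT ITS STEP `t` WITH `r_μ + t = L − 1`**: the bond `⟨x + te_μ, μ⟩` (`t < L`) of the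
straight segment `[x, x + Le_μ]` is a face bond of `c` iff `r_μ + t = L − 1`; before that it is interior to `B(c₋)`, after it interior to `B(c₊)`
(lit ✓`blockOf_shiftN_blockSite_of_le ∕ _of_ge`). [cite: Balaban1987RG1, (0.4) p.253] -/
theorem run_step_face_iff (hj : j + 1 ≤ P.m + P.K) (c : PBond P (j + 1)) (r : Fin P.d → Fin P.L) {t : ℕ} (ht : t < P.L) :
    (blockOf (shiftN (Site.blockSite c.src r) c.dir t) = c.src ∧
        blockOf (PBond.tgt ⟨shiftN (Site.blockSite c.src r) c.dir t, c.dir⟩) = c.tgt) ↔ (r c.dir : ℕ) + t = P.L - 1 := by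
  have ha := (r c.dir).isLt
  have hne : c.tgt ≠ c.src := (src_ne_tgt c).symm
  have htgt : PBond.tgt ⟨shiftN (Site.blockSite c.src r) c.dir t, c.dir⟩ = shiftN (Site.blockSite c.src r) c.dir (t + 1) := rfl
  rw [htgt]
  rcases Nat.lt_trichotomy ((r c.dir : ℕ) + t) (P.L - 1) with h | h | h
  · rw [blockOf_shiftN_blockSite_of_le hj c r t h.le, blockOf_shiftN_blockSite_of_le hj c r (t + 1) (by omega)]
    constructor
    · rintro ⟨-, h2⟩; exact absurd h2.symm hne
    · intro h2; omega
  · rw [blockOf_shiftN_blockSite_of_le hj c r t h.le, blockOf_shiftN_blockSite_of_ge hj c r (t + 1) (by omega) (by omega)]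
    simp [h]
  · rw [blockOf_shiftN_blockSite_of_ge hj c r t (by omega) ht.le]
    constructor
    · rintro ⟨h1, -⟩; exact absurd h1 hne
    · intro h2; omega

/-- ★ **EVERY RUN CROSSES THE FACE EXACTLY ONCE**: among the `L` bonds of the segment from `blockSite c₋ r` exactly one is a face bond of `c`.
[cite: Balaban1987RG1, (0.4) p.253] -/
theorem card_run_face (hj : j + 1 ≤ P.m + P.K) (c : PBond P (j + 1)) (r : Fin P.d → Fin P.L) :
    ((range P.L).filter fun t => blockOf (shiftN (Site.blockSite c.src r) c.dir t) = c.src ∧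
        blockOf (PBond.tgt ⟨shiftN (Site.blockSite c.src r) c.dir t, c.dir⟩) = c.tgt).card = 1 := by
  have ha := (r c.dir).isLt
  rw [card_eq_one]
  refine ⟨P.L - 1 - r c.dir, ?_⟩
  ext t
  simp only [mem_filter, mem_range, mem_singleton]
  constructor
  · rintro ⟨ht, h⟩
    have := (run_step_face_iff hj c r ht).1 h
    omega
  · intro h
    subst h
    exact ⟨by omega, (run_step_face_iff hj c r (by omega)).2 (by omega)⟩

/-- THE CROSSING BOND OF A RUN IN CLOSED FORM: `x + (L − 1 − r_μ)e_μ` is the block site with the `μ`-offset raised to `L − 1`. [cite: Balaban1987RG1, (0.3) p.252] -/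
theorem run_face_site_eq (hj : j + 1 ≤ P.m + P.K) (c : PBond P (j + 1)) (r : Fin P.d → Fin P.L) :
    shiftN (Site.blockSite c.src r) c.dir (P.L - 1 - r c.dir) =
      Site.blockSite c.src (Function.update r c.dir ⟨P.L - 1, Nat.sub_lt P.L_pos Nat.one_pos⟩) := by
  have ha := (r c.dir).isLt
  rw [shiftN_blockSite_eq_of_le hj c.src r c.dir (P.L - 1 - r c.dir) (by omega)]
  have hfin : (⟨(r c.dir : ℕ) + (P.L - 1 - r c.dir), by have := P.hL.2; omega⟩ : Fin P.L) = ⟨P.L - 1, Nat.sub_lt P.L_pos Nat.one_pos⟩ :=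
    Fin.ext (by simp only; omega)
  rw [hfin]

/-- THE FACE SET READ THROUGH OFFSETS: a sum over the face bonds of `c` is the sum over the offsets `r` with `r_μ = L − 1` of the bonds `⟨blockSite c₋ r, μ⟩`
(lit `Site.blockEquiv`). [cite: Balaban1987RG1, (0.3) p.252] -/
theorem sum_face_eq_sum_offset {M : Type*} [AddCommMonoid M] (hj : j + 1 ≤ P.m + P.K) (c : PBond P (j + 1)) (g : PBond P j → M) :
    ∑ f ∈ univ.filter (fun ℓ : PBond P j => ℓ.dir = c.dir ∧ blockOf ℓ.src = c.src ∧ blockOf ℓ.tgt = c.tgt), g f =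
      ∑ r ∈ univ.filter (fun r : Fin P.d → Fin P.L => (r c.dir : ℕ) + 1 = P.L), g ⟨Site.blockSite c.src r, c.dir⟩ := by
  classical
  have hinj : ∀ r ∈ univ.filter (fun r : Fin P.d → Fin P.L => (r c.dir : ℕ) + 1 = P.L),
      ∀ r' ∈ univ.filter (fun r : Fin P.d → Fin P.L => (r c.dir : ℕ) + 1 = P.L),
        (⟨Site.blockSite c.src r, c.dir⟩ : PBond P j) = ⟨Site.blockSite c.src r', c.dir⟩ → r = r' := by
    intro r _ r' _ h
    have h1 : Site.blockSite c.src r = Site.blockSite c.src r' := congrArg PBond.src h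
    exact (Site.blockEquiv hj c.src).symm.injective (Subtype.ext h1)
  rw [← Finset.sum_image hinj]
  refine Finset.sum_congr ?_ fun _ _ => rfl
  ext ℓ
  simp only [mem_filter, mem_univ, true_and, mem_image]
  rw [mem_face_iff hj]
  constructor
  · rintro ⟨hd, hs, htop⟩
    refine ⟨Site.blockEquiv hj c.src ⟨ℓ.src, hs⟩, ?_, ?_⟩
    · show (ℓ.src c.dir).val % P.L + 1 = P.L
      rw [← hd]; exact htop
    · have h1 : Site.blockSite c.src (Site.blockEquiv hj c.src ⟨ℓ.src, hs⟩) = ℓ.src :=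
        congrArg Subtype.val ((Site.blockEquiv hj c.src).symm_apply_apply ⟨ℓ.src, hs⟩)
      rw [h1]; cases ℓ; simp only at hd; subst hd; rfl
  · rintro ⟨r, hr, rfl⟩
    refine ⟨rfl, Site.blockOf_blockSite hj c.src r, ?_⟩
    show ((Site.blockSite c.src r) c.dir).val % P.L + 1 = P.L
    rw [Site.val_blockSite hj, Nat.mul_add_mod', Nat.mod_eq_of_lt (r c.dir).isLt]
    exact hr

/-- ★★ **RUN → FACE: EACH FACE BOND IS CROSSED BY EXACTLY `L` RUNS** (one per position of `x` along `μ` inside `B(c₋)`): for every `g`,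
`Σ_{r ∈ {0,…,L−1}^d} g(crossing bond of the run from blockSite c₋ r) = L • Σ_{f ∈ face(c)} g f` — so the uniform mean over the `L^d` runs of a
function of the crossed face bond is the uniform mean over the `L^{d−1}` face bonds. [cite: Balaban1987RG1, (0.4) p.253] -/
theorem sum_offset_run_face {M : Type*} [AddCommMonoid M] (hj : j + 1 ≤ P.m + P.K) (c : PBond P (j + 1)) (g : PBond P j → M) :
    ∑ r : Fin P.d → Fin P.L, g ⟨shiftN (Site.blockSite c.src r) c.dir (P.L - 1 - r c.dir), c.dir⟩ =
      P.L • ∑ f ∈ univ.filter (fun ℓ : PBond P j => ℓ.dir = c.dir ∧ blockOf ℓ.src = c.src ∧ blockOf ℓ.tgt = c.tgt), g f := by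
  classical
  have hL1 := P.hL.2
  have hterm : ∀ r : Fin P.d → Fin P.L, g ⟨shiftN (Site.blockSite c.src r) c.dir (P.L - 1 - r c.dir), c.dir⟩ =
      (fun r' : Fin P.d → Fin P.L => g ⟨Site.blockSite c.src r', c.dir⟩)
        (Function.update r c.dir ⟨P.L - 1, Nat.sub_lt P.L_pos Nat.one_pos⟩) := by
    intro r; simp only [run_face_site_eq hj c r]
  rw [Finset.sum_congr rfl (fun r _ => hterm r), sum_face_eq_sum_offset hj c g,
    Finset.sum_comp (fun r' : Fin P.d → Fin P.L => g ⟨Site.blockSite c.src r', c.dir⟩)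
      (fun r : Fin P.d → Fin P.L => Function.update r c.dir ⟨P.L - 1, Nat.sub_lt P.L_pos Nat.one_pos⟩)]
  have himg : (univ : Finset (Fin P.d → Fin P.L)).image (fun r => Function.update r c.dir (⟨P.L - 1, Nat.sub_lt P.L_pos Nat.one_pos⟩ : Fin P.L)) =
      univ.filter (fun r : Fin P.d → Fin P.L => (r c.dir : ℕ) + 1 = P.L) := by
    ext r'
    simp only [mem_image, mem_univ, true_and, mem_filter]
    constructor
    · rintro ⟨r, rfl⟩
      rw [Function.update_self]
      show (P.L - 1) + 1 = P.L
      omega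
    · intro h
      refine ⟨r', ?_⟩
      have h1 : r' c.dir = ⟨P.L - 1, Nat.sub_lt P.L_pos Nat.one_pos⟩ := Fin.ext (by simp only; omega)
      rw [← h1, Function.update_eq_self]
  rw [himg, Finset.smul_sum]
  refine Finset.sum_congr rfl fun r' hr' => ?_
  have hr'top : r' c.dir = ⟨P.L - 1, Nat.sub_lt P.L_pos Nat.one_pos⟩ := by
    rw [mem_filter] at hr'
    exact Fin.ext (by simp only; omega)
  have hfib : (univ.filter fun r : Fin P.d → Fin P.L => Function.update r c.dir (⟨P.L - 1, Nat.sub_lt P.L_pos Nat.one_pos⟩ : Fin P.L) = r') =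
      (univ : Finset (Fin P.L)).image (fun a => Function.update r' c.dir a) := by
    ext r
    simp only [mem_filter, mem_univ, true_and, mem_image]
    constructor
    · intro h
      refine ⟨r c.dir, ?_⟩
      rw [← h, Function.update_idem, Function.update_eq_self]
    · rintro ⟨a, rfl⟩
      rw [Function.update_idem, ← hr'top, Function.update_eq_self]
  rw [hfib, card_image_of_injective _ (Function.update_injective _ c.dir), card_univ, Fintype.card_fin]

/-- ★★ **THE (0.4) INDEX SET**: summed over ALL indices `i = (r, σ, σ′) ∈ Idx P` of the double average at `c` (`(d!)²·L^d` runs), a function of the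
face bond crossed by the run of `i` counts each face bond `(d!)²·L` times (✓`sum_idx_const_perm` ∘ `sum_offset_run_face`). [cite: Balaban1987RG1, (0.4) p.253] -/
theorem sum_idx_run_face {M : Type*} [AddCommMonoid M] (hj : j + 1 ≤ P.m + P.K) (c : PBond P (j + 1)) (g : PBond P j → M) :
    ∑ i : Idx P, g ⟨shiftN (Site.blockSite c.src i.1) c.dir (P.L - 1 - i.1 c.dir), c.dir⟩ =
      (Fintype.card (Equiv.Perm (Fin P.d)) * Fintype.card (Equiv.Perm (Fin P.d)) * P.L) •
        ∑ f ∈ univ.filter (fun ℓ : PBond P j => ℓ.dir = c.dir ∧ blockOf ℓ.src = c.src ∧ blockOf ℓ.tgt = c.tgt), g f := by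
  rw [sum_idx_const_perm (F := fun r : Fin P.d → Fin P.L => g ⟨shiftN (Site.blockSite c.src r) c.dir (P.L - 1 - r c.dir), c.dir⟩),
    sum_offset_run_face hj c g, smul_smul]

end Summit.QuantumFields.YangMills.Theorems.FluctuationComparisonRegPrIntLS2BetaFaceTubeRuns
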